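import Literature.NumberTheory.LFunctions.Zhang2022.EllFirstOrderBox
import HarnessLib

/-!
# Zhang (2022), B-ell first-order reading: TEST #1 IS A CONSEQUENCE of «exact non-negativity at every `A`» +
# «dict-1 is the `1/A`-expansion» — the TIER-1 mechanism of the B-ell word in the kernel (cell `landau-siegel`,
# family B-ell; theorems only)

Topic `Literature/NumberTheory/LFunctions/Zhang2022` (Landau–Siegel audit tree; verdict-neutral).
Y. Zhang, arXiv:2211.02515v1 (2022) [Zhang2022LandauSiegel] is an unrefereed manuscript under
adjudication; NOTHING here asserts or denies its Theorems 1–2 and nothing here is a claim about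
Landau–Siegel zeros.  Theorems only (no `def`): elementary real analysis over ls-Bell-typer-1's SET-form first-order
vocabulary (`EllRegime.firstOrderValue`, `ModelConsistentOn`, `ClosesFirstOrderOn`, `EllRegimeStatements.lean` Part 6).

WHY.  The B-ell KILL form of record (B-ell/KILL-draft.md v0.5 §1; ls-Bell-plan 21:11:39Z «TIER 1») reads: «at the
model's own data every order-`ε` coefficient the dictionary displays IS the `⟨A⟩`-model expectation, and the model
form is PSD / satisfies Cauchy–Schwarz EXACTLY at every `A`; hence the first-order value at model data is `≥ 0`»
— i.e. test #1 (`ModelConsistentOn 𝓜 …`, ls-ref-1 17:32:27Z) is not an extra assumption but a CONSEQUENCE of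
(i) B-AH on the dressed lattice family (an exact non-negative quantity `Q_A(d; λ, c′) ≥ 0` at EVERY `A`) and
(ii) dict-1 = its `1/A`-expansion with vanishing zeroth order (`Q_A = v₁/A + O(K/A²)`, `v₁` = the first-order value).
This file proves exactly that implication, abstractly:

* `nonneg_of_eventually_div_add_div_sq_nonneg` — if `0 ≤ q/A + r(A)/A²` with `|r(A)| ≤ K` for all `A ≥ A₀ > 0`,
  then `0 ≤ q` (a negative `q` would win for large `A`);
* `modelConsistentOn_of_expansion` — **test #1 from B-AH + expansion**: if at every model datum `p ∈ 𝓜` some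
  quantity is `≥ 0` for all large `A` and equals `firstOrderValue(p)/A` up to `K/A²`, then `ModelConsistentOn 𝓜`;
* `not_closesFirstOrderOn_of_expansion` — hence no robust closing over any box `M` meeting `𝓜` (TIER 1 verbatim:
  `R(d) ∩ 𝓜 = ∅`);
* the Cauchy–Schwarz currency (tie+tent/G5/G6 sheets): `csMargin_expansion` — the exact identity
  `D·J − X² = (D₀J₀ − X₀²) + (D₀J₁ + D₁J₀ − 2X₀X₁)/A + R/A²` for `D = D₀ + D₁/A + d/A²`, `J = J₀ + J₁/A + j/A²`,
  `X = X₀ + X₁/A + x/A²` with `R` EXPLICIT (`csRemainder`, a polynomial in the pieces and `1/A`), and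
  `csFirstOrder_nonneg_of_exact` — if CS holds EXACTLY at every `A ≥ A₀` (`X(A)² ≤ D(A)J(A)`, B-AH (B1)), the zeroth
  order is an EQUALITY (`D₀J₀ = X₀²`, the CS-edge corner where the `ε`-windows live) and the remainder is bounded
  (`|R(A)| ≤ K`), then the FIRST-ORDER CS MARGIN `D₀J₁ + D₁J₀ − 2X₀X₁ ≥ 0` — the model cannot «close at first order»
  on the CS sheet either.

So in the word, «GIVEN B-AH(dressed)» + «dict-1 DERIVED as the model's expansion» ⇒ test #1 by THEOREM; what can
fail is only (ii) — a displayed order-`1/A` term that is NOT a model expectation (door (α′), theory's (δ)/(δ′)).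

## References
* Y. Zhang, arXiv:2211.02515v1 (2022), §2 Lemma 2.3, (2.16)–(2.20) (exact positivity and Cauchy–Schwarz of the
  discrete means), (2.32)–(2.33). [Zhang2022LandauSiegel]

«The programme SEARCHES and TYPES; no claim about Landau–Siegel zeros, Theorems 1–2 of arXiv:2211.02515 or
a repaired Margin232 until a kernel theorem says so.»
-/

noncomputable section

open Real Set

namespace Literature.NumberTheory.LFunctions.Zhang2022.EllRegime

/-! ## The scalar mechanism: a negative first-order coefficient beats any `O(1/A²)` remainder -/

/-- If `0 ≤ q/A + r(A)/A²` with `|r(A)| ≤ K` for every `A ≥ A₀` (`A₀ > 0`), then `0 ≤ q`.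
[cite: Zhang2022LandauSiegel, §2 (2.16), (2.32)] -/
theorem nonneg_of_eventually_div_add_div_sq_nonneg {q K A₀ : ℝ} (hA₀ : 0 < A₀) {r : ℝ → ℝ}
    (hr : ∀ A, A₀ ≤ A → |r A| ≤ K) (h : ∀ A, A₀ ≤ A → 0 ≤ q / A + r A / A ^ 2) : 0 ≤ q := by
  by_contra hq
  push Not at hq
  -- take `A = max A₀ ((K + 1)/(−q))`: then `qA ≤ −(K+1) < −K ≤ −r(A)`, so `qA + r(A) < 0`
  set A : ℝ := max A₀ ((K + 1) / (-q)) with hA_def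
  have hAA₀ : A₀ ≤ A := le_max_left _ _
  have hApos : 0 < A := lt_of_lt_of_le hA₀ hAA₀
  have hK : |r A| ≤ K := hr A hAA₀
  have hqA : q * A ≤ -(K + 1) := by
    have h1 : (K + 1) / (-q) ≤ A := le_max_right _ _
    have hnq : 0 < -q := by linarith
    have h2 : K + 1 ≤ A * (-q) := by rwa [div_le_iff₀ hnq] at h1
    linarith
  have hneg : q * A + r A < 0 := by
    have := le_abs_self (r A)
    linarith
  have hval := h A hAA₀
  have hA2 : 0 < A ^ 2 := by positivity
  have key : q / A + r A / A ^ 2 = (q * A + r A) / A ^ 2 := by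
    field_simp
  rw [key] at hval
  have := div_neg_of_neg_of_pos hneg hA2
  linarith

/-! ## Test #1 from «exact non-negativity at every A» + «dict-1 = the 1/A-expansion» -/

variable {gain G₀ G₁ G₂ : ℝ}

/-- **`ModelConsistentOn` DERIVED (TIER 1):** suppose that at every model-admissible datum `p ∈ 𝓜` there are
`A₀ > 0`, `K` and a quantity `Q : ℝ → ℝ` (the exact model discrete mean, normalised so that its zeroth order
vanishes) with `0 ≤ Q A` for all `A ≥ A₀` (B-AH on the dressed family: exact positivity) and
`|Q A − firstOrderValue(p)/A| ≤ K/A²` (dict-1 IS the model's expansion).  Then test #1 holds on `𝓜`.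
[cite: Zhang2022LandauSiegel, §2 Lemma 2.3, (2.16), (2.32)] -/
theorem modelConsistentOn_of_expansion {𝓜 : Set (ℝ × ℝ)}
    (h : ∀ p ∈ 𝓜, ∃ (A₀ K : ℝ) (Q : ℝ → ℝ), 0 < A₀ ∧ (∀ A, A₀ ≤ A → 0 ≤ Q A) ∧
      ∀ A, A₀ ≤ A → |Q A - firstOrderValue gain G₀ G₁ G₂ p / A| ≤ K / A ^ 2) :
    ModelConsistentOn 𝓜 gain G₀ G₁ G₂ := by
  intro p hp
  obtain ⟨A₀, K, Q, hA₀, hQ, hexp⟩ := h p hp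
  -- remainder `r(A) := A²·(Q A − v/A)`, bounded by `K`
  refine nonneg_of_eventually_div_add_div_sq_nonneg hA₀ (K := K)
    (r := fun A => A ^ 2 * (Q A - firstOrderValue gain G₀ G₁ G₂ p / A)) (fun A hA => ?_) (fun A hA => ?_)
  · have hApos : 0 < A := lt_of_lt_of_le hA₀ hA
    have hA2 : 0 < A ^ 2 := by positivity
    have := hexp A hA
    rw [abs_mul, abs_of_pos hA2]
    calc A ^ 2 * |Q A - firstOrderValue gain G₀ G₁ G₂ p / A| ≤ A ^ 2 * (K / A ^ 2) :=
          mul_le_mul_of_nonneg_left this hA2.le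
      _ = K := by field_simp
  · have hApos : 0 < A := lt_of_lt_of_le hA₀ hA
    have hA2 : (A ^ 2 : ℝ) ≠ 0 := by positivity
    have e : firstOrderValue gain G₀ G₁ G₂ p / A +
        A ^ 2 * (Q A - firstOrderValue gain G₀ G₁ G₂ p / A) / A ^ 2 = Q A := by
      field_simp
      ring
    rw [e]
    exact hQ A hA

/-- **TIER 1 verbatim: `R(d) ∩ 𝓜 = ∅`.**  Under the hypotheses of `modelConsistentOn_of_expansion`, the design does
not close robustly over ANY admissible box `M` that meets `𝓜`. [cite: Zhang2022LandauSiegel, §2 Lemma 2.3, (2.32)] -/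
theorem not_closesFirstOrderOn_of_expansion {𝓜 M : Set (ℝ × ℝ)}
    (h : ∀ p ∈ 𝓜, ∃ (A₀ K : ℝ) (Q : ℝ → ℝ), 0 < A₀ ∧ (∀ A, A₀ ≤ A → 0 ≤ Q A) ∧
      ∀ A, A₀ ≤ A → |Q A - firstOrderValue gain G₀ G₁ G₂ p / A| ≤ K / A ^ 2)
    (hmeet : (𝓜 ∩ M).Nonempty) : ¬ ClosesFirstOrderOn M gain G₀ G₁ G₂ :=
  not_closesFirstOrderOn_of_modelConsistentOn (modelConsistentOn_of_expansion h) hmeet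

/-! ## The Cauchy–Schwarz currency: first-order CS margin from exact CS at every `A` -/

/-- The explicit `1/A²`-remainder of `D·J − X²` under first-order expansions with remainders
`D = D₀ + D₁u + d u²`, `J = J₀ + J₁u + j u²`, `X = X₀ + X₁u + x u²` (`u = 1/A`):
`D·J − X² = (D₀J₀ − X₀²) + (D₀J₁ + D₁J₀ − 2X₀X₁)u + csRemainder·u²`. [cite: Zhang2022LandauSiegel, §2 (2.18)–(2.20), (2.32)–(2.33)] -/
theorem csMargin_expansion (D₀ D₁ d J₀ J₁ j X₀ X₁ x u : ℝ) :
    (D₀ + D₁ * u + d * u ^ 2) * (J₀ + J₁ * u + j * u ^ 2) - (X₀ + X₁ * u + x * u ^ 2) ^ 2 =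
      (D₀ * J₀ - X₀ ^ 2) + (D₀ * J₁ + D₁ * J₀ - 2 * X₀ * X₁) * u +
        ((D₀ * j + D₁ * J₁ + d * J₀ - X₁ ^ 2 - 2 * X₀ * x) + (D₁ * j + d * J₁ - 2 * X₁ * x) * u +
          (d * j - x ^ 2) * u ^ 2) * u ^ 2 := by
  ring

/-- **First-order CS margin `≥ 0` from EXACT CS at every `A` (B-AH (B1)) at a CS-EDGE corner.**  Let the model's
three means expand as `D(A) = D₀ + D₁/A + d(A)/A²`, `J(A) = J₀ + J₁/A + j(A)/A²`, `X(A) = X₀ + X₁/A + x(A)/A²` with the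
three remainder coefficients giving a bounded `csRemainder` (`|R(A)| ≤ K` for `A ≥ A₀`), suppose CS holds exactly,
`X(A)² ≤ D(A)·J(A)` for `A ≥ A₀ > 0`, and the zeroth order is an equality `D₀J₀ = X₀²` (where the `ε`-windows live).
Then `0 ≤ D₀J₁ + D₁J₀ − 2X₀X₁`: the model does not close at first order on the CS sheet.
[cite: Zhang2022LandauSiegel, §2 (2.18)–(2.20), (2.32)–(2.33)] -/
theorem csFirstOrder_nonneg_of_exact {D₀ D₁ J₀ J₁ X₀ X₁ A₀ K : ℝ} {d j x : ℝ → ℝ} (hA₀ : 0 < A₀)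
    (h0 : D₀ * J₀ = X₀ ^ 2)
    (hR : ∀ A, A₀ ≤ A → |(D₀ * j A + D₁ * J₁ + d A * J₀ - X₁ ^ 2 - 2 * X₀ * x A) +
        (D₁ * j A + d A * J₁ - 2 * X₁ * x A) * (1 / A) + (d A * j A - x A ^ 2) * (1 / A) ^ 2| ≤ K)
    (hCS : ∀ A, A₀ ≤ A → (X₀ + X₁ * (1 / A) + x A * (1 / A) ^ 2) ^ 2 ≤
        (D₀ + D₁ * (1 / A) + d A * (1 / A) ^ 2) * (J₀ + J₁ * (1 / A) + j A * (1 / A) ^ 2)) :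
    0 ≤ D₀ * J₁ + D₁ * J₀ - 2 * X₀ * X₁ := by
  refine nonneg_of_eventually_div_add_div_sq_nonneg hA₀
    (r := fun A => (D₀ * j A + D₁ * J₁ + d A * J₀ - X₁ ^ 2 - 2 * X₀ * x A) +
        (D₁ * j A + d A * J₁ - 2 * X₁ * x A) * (1 / A) + (d A * j A - x A ^ 2) * (1 / A) ^ 2) hR (fun A hA => ?_)
  have hApos : 0 < A := lt_of_lt_of_le hA₀ hA
  have key := csMargin_expansion D₀ D₁ (d A) J₀ J₁ (j A) X₀ X₁ (x A) (1 / A)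
  have hmargin : 0 ≤ (D₀ + D₁ * (1 / A) + d A * (1 / A) ^ 2) * (J₀ + J₁ * (1 / A) + j A * (1 / A) ^ 2) -
      (X₀ + X₁ * (1 / A) + x A * (1 / A) ^ 2) ^ 2 := sub_nonneg.mpr (hCS A hA)
  rw [key, h0, sub_self, zero_add] at hmargin
  have e1 : (D₀ * J₁ + D₁ * J₀ - 2 * X₀ * X₁) * (1 / A) = (D₀ * J₁ + D₁ * J₀ - 2 * X₀ * X₁) / A := by ring
  have e2 : ∀ R : ℝ, R * (1 / A) ^ 2 = R / A ^ 2 := fun R => by field_simp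
  rw [e1, e2] at hmargin
  exact hmargin

/-- **Positivity currency, one functional:** if `Q(A) = q₀ + q₁/A + r(A)/A² ≥ 0` for all `A ≥ A₀ > 0` with
`q₀ = 0` (a KERNEL direction: `F₁(u) = 0`) and `|r| ≤ K`, then `q₁ ≥ 0` — the `K₀` case of TIER 1 (cf. the exact
frame values `A·φ → +16π, +4π, +4π` of `EllRegimeK0Instances`). [cite: Zhang2022LandauSiegel, §2 Lemma 2.3, (2.16), (2.32)] -/
theorem firstOrder_nonneg_of_kernelDirection {q₀ q₁ A₀ K : ℝ} {r : ℝ → ℝ} (hA₀ : 0 < A₀) (h0 : q₀ = 0)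
    (hr : ∀ A, A₀ ≤ A → |r A| ≤ K) (hQ : ∀ A, A₀ ≤ A → 0 ≤ q₀ + q₁ / A + r A / A ^ 2) : 0 ≤ q₁ := by
  subst h0
  exact nonneg_of_eventually_div_add_div_sq_nonneg hA₀ hr (fun A hA => by simpa using hQ A hA)

end Literature.NumberTheory.LFunctions.Zhang2022.EllRegime

end
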